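import Literature.MathematicalPhysics.QuantumLattice.InfiniteVolumeStates
import HarnessLib

/-!
# Translation-invariant ground states are the minimisers of the energy per unit volume
# (Bratteli–Kishimoto–Robinson 1978, Theorem 2)

Topic `Literature/MathematicalPhysics/QuantumLattice`; companion of `InfiniteVolumeStates.lean`
(`InfVolState`, `InfVolState.IsGroundState`, `InfVolState.IsTranslationInvariant`,
`InfVolState.mix`, `LatticeInteraction.HasFiniteRange/IsTranslationInvariant`), in exactly its
vocabulary (quantum SPIN systems on `ℤ^d`, local dimension `q`). Requested by cite item wi-37918
for route `HubbardSuperconductivity/InfiniteVolumeFirst` (crux `NoNormalLimitState`): "a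
translation-invariant state is a ground state iff it minimises the mean energy; the minimisers
form a face of the invariant states, so their extreme points are ergodic". The printed theorem is
vendored as ONE named fact (D-0014) for spin systems — the carrier the tree has today; the even-CAR
twin awaits the definition request `InfVolFermionState` of that route — and the convexity
consequences (affinity of the mean energy, the face property, ergodicity of extremal minimisers)
are PROVED here from it.

## Source and what is printed (held text `paper:doi-10-1007-bf01940760`)

O. Bratteli, A. Kishimoto, D. W. Robinson, *Ground states of quantum spin systems*, Commun. Math.
Phys. 64 (1978) 41–48 [BratteliKishimotoRobinson1978].

* Abstract (p. 41): "We prove that ground states of quantum spin systems are characterized by a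
  principle of minimum local energy and that translationally invariant ground states are
  characterized by the principle of minimum energy per unit volume."
* §1 (p. 41): "A state `ω` over `𝔄` is defined to be a `τ`-ground state if `-i ω(A* δ(A)) ≥ 0`
  for all `A` in the domain `D(δ)` of `δ`."
* §3 (p. 47): "the interaction `Φ` is `ℤ^ν`-invariant if `Φ(X + x) = α_x(Φ(X))` … one can define
  a mean energy functional over the set of `ℤ^ν`-invariant states `E^{ℤ^ν}` by
  `H_Φ(ω) = lim_{Λ→∞} ω(H_Φ(Λ))/|Λ|` whenever `‖Φ‖ = Σ_{X∋0} ‖Φ(X)‖/|X| < +∞`."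
  **Theorem 2.** "Let `Φ` be a `ℤ^ν`-invariant interaction such that
  `‖Φ‖_λ = Σ_{X∋0} ‖Φ(X)‖ e^{λ|X|} < +∞` for some `λ > 0` and let `τ^Φ` denote the associated
  dynamical group. If `ω` is a `ℤ^ν`-invariant state the following are equivalent:
  1. `ω` is a `τ^Φ`-ground state, 2. `ω` minimizes `H_Φ`." (Proof pp. 47–48: `1 ⇒ 2` from their
  Theorem 1, the principle of minimum local energy; `2 ⇒ 1` is Ruelle, Commun. Math. Phys. 11
  (1968) 339.) Restated in Bratteli–Robinson II, §6.2.7 [BratteliRobinsonII1997].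
* Ergodic states: Bratteli–Robinson I, §4.3.1 [BratteliRobinsonI1987]: "The extremal
  `G`-invariant states `𝓔(E_𝔄^G)` are usually called ergodic states, or `G`-ergodic states".

## Rendering and faithfulness

* Interactions: the tree's `LatticeInteraction d q` of FINITE RANGE `R` (`HasFiniteRange`),
  Hermitian and translation invariant — a special case of the printed hypothesis (a
  translation-invariant finite-range interaction has finitely many translation classes of regions
  `X ∋ 0`, so `‖Φ‖_λ < ∞` for every `λ`); the fact is correspondingly WEAKER than print, never
  stronger. States: `InfVolState d q` (compatible families of local states = states of the
  quasi-local algebra, `existsUnique_state_of_infVolState`); "`ℤ^ν`-invariant" =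
  `InfVolState.IsTranslationInvariant`; "`τ^Φ`-ground state" = the tree's LOCAL form
  `InfVolState.IsGroundState Φ R` (`-i ω(A⋆δ(A)) ≥ 0` for local `A`, `δ = derivation Φ R`;
  equivalent to the printed condition on `D(δ)` because the local algebra is a core for `δ`, the
  standing hypothesis of the source's Theorem 1, Bratteli–Robinson II Thm. 6.2.4).
* Mean energy: for a TRANSLATION-INVARIANT state and a finite-range interaction the printed
  van Hove limit `H_Φ(ω) = lim ω(H_Φ(Λ))/|Λ|` equals `ω(E_Φ)` for the local **mean energy
  observable** `E_Φ = Σ_{X ∋ 0} Φ(X)/|X| ∈ 𝔄_{Λ_R}`, `Λ_R = thicken {0} R`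
  (Bratteli–Robinson II §6.2.4: `ω(H_Φ(Λ)) = Σ_{x∈Λ} Σ_{X∋x, X⊆Λ} ω(Φ(X))/|X|
  = |Λ| ω(E_Φ) + O(|∂_R Λ|)` by translation invariance). Since the theorem only concerns invariant
  states, "`ω` minimizes `H_Φ`" is rendered `∀ ω' invariant, e_Φ(ω) ≤ e_Φ(ω')` with
  `InfVolState.meanEnergy Φ R ω = Re ω(E_Φ)` (`ω(E_Φ)` is real, `E_Φ` being Hermitian) — no limit
  is needed to STATE the fact, and this identification is the only reading made.
* PROVED here (no further hypothesis): the mean energy is affine under `InfVolState.mix`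
  (`meanEnergy_mix`); translates of mixtures (`shift_mix`, `IsTranslationInvariant.mix`); the
  minimisers — hence, given the fact, the translation-invariant ground states — form a FACE of the
  convex set of invariant states (`IsMeanEnergyMinimiser.of_mix_left/right`,
  `BratteliKishimotoRobinson1978_theorem2.isGroundState_of_mix`); and an invariant minimiser that
  is extremal among minimisers is ERGODIC, i.e. extremal among all invariant states
  (`IsMeanEnergyMinimiser.isErgodic_of_extremal`; `InfVolState.IsErgodic` = extremality in the
  invariant states, Bratteli–Robinson I §4.3.1). Weak⋆-closedness of the minimiser set and the
  ergodic DECOMPOSITION (Choquet theory on `E^{ℤ^ν}`, Bratteli–Robinson I §4.3.1) are not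
  stated: the tree has no topology or measure theory on `InfVolState` yet.

## References

* [BratteliKishimotoRobinson1978] Commun. Math. Phys. 64 (1978) 41–48, Thm. 2 (p. 47), §3.
* [BratteliRobinsonII1997] O. Bratteli, D. W. Robinson, *Operator Algebras and Quantum
  Statistical Mechanics 2*, 2nd ed., §6.2.4 (mean energy), §6.2.7 (ground states of spin systems).
* [BratteliRobinsonI1987] *Operator Algebras and Quantum Statistical Mechanics 1*, 2nd ed.,
  §4.3.1 (ergodic = extremal invariant states).
-/

noncomputable section

open Finset Literature.Probability.LatticeModels

namespace Literature.MathematicalPhysics.QuantumLattice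

variable {d q : ℕ}

/-! ### The mean energy observable and the mean energy of a state -/

/-- The origin lies in its own `R`-neighbourhood `Λ_R = thicken {0} R`. [folklore] -/
theorem zero_mem_thicken_zero (R : ℝ) :
    (0 : Site d) ∈ thicken ({0} : Finset (Site d)) R :=
  subset_thicken _ R (mem_singleton_self _)

/-- **The mean energy observable** `E_Φ = Σ_{X ∋ 0} Φ(X)/|X|` of a finite-range interaction
(range `R`), as an element of the local algebra `𝔄_{Λ_R}`, `Λ_R = thicken {0} R` (every region
`X ∋ 0` with `Φ X ≠ 0` has diameter `≤ R`, hence lies in `Λ_R`; the terms are those of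
`Φ.restrict Λ_R`). For a translation-invariant state `ω`, `ω(E_Φ)` is the energy per unit volume
`lim ω(H_Φ(Λ))/|Λ|`. Bratteli–Robinson II §6.2.4; Bratteli–Kishimoto–Robinson 1978, §3.
[cite: BratteliKishimotoRobinson1978, §3 (mean energy functional)] -/
def meanEnergyObs (Φ : LatticeInteraction d q) (R : ℝ) :
    Op ↥(thicken ({0} : Finset (Site d)) R) q :=
  ∑ X ∈ (univ : Finset ↥(thicken ({0} : Finset (Site d)) R)).powerset with
      (⟨0, zero_mem_thicken_zero R⟩ : ↥(thicken ({0} : Finset (Site d)) R)) ∈ X,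
    ((X.card : ℂ)⁻¹) • (Φ.restrict (thicken ({0} : Finset (Site d)) R)) X

namespace InfVolState

/-- **The mean energy** (energy per unit volume) `e_Φ(ω) = Re ω(E_Φ)` of the state `ω` for the
finite-range interaction `Φ` (range `R`); for translation-invariant `ω` this is the printed
`H_Φ(ω) = lim_Λ ω(H_Φ(Λ))/|Λ|` (module docstring, "Rendering").
[cite: BratteliKishimotoRobinson1978, §3 (mean energy functional `H_Φ`)] -/
def meanEnergy (Φ : LatticeInteraction d q) (R : ℝ) (ω : InfVolState d q) : ℝ :=
  (ω.expect _ (meanEnergyObs Φ R)).re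

/-- `ω` **minimises the mean energy**: `ω` is translation invariant and `e_Φ(ω) ≤ e_Φ(ω')` for
every translation-invariant `ω'` ("`ω` minimizes `H_Φ`" over `E^{ℤ^ν}`).
[cite: BratteliKishimotoRobinson1978, Thm. 2 (condition 2)] -/
def IsMeanEnergyMinimiser (Φ : LatticeInteraction d q) (R : ℝ) (ω : InfVolState d q) : Prop :=
  ω.IsTranslationInvariant ∧
    ∀ ω' : InfVolState d q, ω'.IsTranslationInvariant → ω.meanEnergy Φ R ≤ ω'.meanEnergy Φ R

/-- **Ergodic state** = translation-invariant state EXTREMAL among the translation-invariant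
states: whenever `ω = t ω₁ + (1 - t) ω₂` with `0 < t < 1` and `ω₁, ω₂` invariant, `ω₁ = ω₂ = ω`.
Bratteli–Robinson I §4.3.1: "The extremal `G`-invariant states are usually called ergodic
states". [cite: BratteliRobinsonI1987, §4.3.1 (definition of G-ergodic states)] -/
def IsErgodic (ω : InfVolState d q) : Prop :=
  ω.IsTranslationInvariant ∧
    ∀ (t : ℝ) (ht₀ : 0 ≤ t) (ht₁ : t ≤ 1) (ω₁ ω₂ : InfVolState d q), 0 < t → t < 1 →
      ω₁.IsTranslationInvariant → ω₂.IsTranslationInvariant → mix t ht₀ ht₁ ω₁ ω₂ = ω →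
        ω₁ = ω ∧ ω₂ = ω

/-! ### Convexity: the mean energy is affine, mixtures of invariant states are invariant -/

/-- **The mean energy is affine**: `e_Φ(t ω₁ + (1-t) ω₂) = t e_Φ(ω₁) + (1-t) e_Φ(ω₂)`.
[folklore] -/
theorem meanEnergy_mix (Φ : LatticeInteraction d q) (R : ℝ) (t : ℝ) (ht₀ : 0 ≤ t) (ht₁ : t ≤ 1)
    (ω₁ ω₂ : InfVolState d q) :
    (mix t ht₀ ht₁ ω₁ ω₂).meanEnergy Φ R =
      t * ω₁.meanEnergy Φ R + (1 - t) * ω₂.meanEnergy Φ R := by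
  simp only [meanEnergy, mix_expect, Complex.add_re, Complex.re_ofReal_mul]

/-- Translating a mixture translates its components. [folklore] -/
theorem shift_mix (v : Site d) (t : ℝ) (ht₀ : 0 ≤ t) (ht₁ : t ≤ 1) (ω₁ ω₂ : InfVolState d q) :
    (mix t ht₀ ht₁ ω₁ ω₂).shift v = mix t ht₀ ht₁ (ω₁.shift v) (ω₂.shift v) :=
  InfVolState.ext fun _ => LinearMap.ext fun _ => rfl

/-- A mixture of translation-invariant states is translation invariant (the invariant states form
a convex set, Bratteli–Robinson I §4.3.1). [cite: BratteliRobinsonI1987, §4.3.1] -/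
theorem IsTranslationInvariant.mix {ω₁ ω₂ : InfVolState d q} (h₁ : ω₁.IsTranslationInvariant)
    (h₂ : ω₂.IsTranslationInvariant) (t : ℝ) (ht₀ : 0 ≤ t) (ht₁ : t ≤ 1) :
    (InfVolState.mix t ht₀ ht₁ ω₁ ω₂).IsTranslationInvariant := fun v => by
  rw [shift_mix, h₁ v, h₂ v]

/-! ### The minimisers of the mean energy form a face of the invariant states -/

/-- **Face property, left component**: if `t ω₁ + (1-t) ω₂` (`0 < t`, `ω₁, ω₂` invariant)
minimises the mean energy, so does `ω₁`. (Affinity: `t e(ω₁) + (1-t) e(ω₂) ≤ e(ω₁), e(ω₂)`.)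
[folklore] -/
theorem IsMeanEnergyMinimiser.of_mix_left {Φ : LatticeInteraction d q} {R t : ℝ} {ht₀ : 0 ≤ t}
    {ht₁ : t ≤ 1} {ω₁ ω₂ : InfVolState d q} (ht : 0 < t) (h₁ : ω₁.IsTranslationInvariant)
    (h₂ : ω₂.IsTranslationInvariant) (h : (mix t ht₀ ht₁ ω₁ ω₂).IsMeanEnergyMinimiser Φ R) :
    ω₁.IsMeanEnergyMinimiser Φ R := by
  refine ⟨h₁, fun ω' hω' => ?_⟩
  have hm₁ := h.2 ω₁ h₁
  have hm₂ := h.2 ω₂ h₂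
  have hm' := h.2 ω' hω'
  rw [meanEnergy_mix] at hm₁ hm₂ hm'
  nlinarith

/-- **Face property, right component**: if `t ω₁ + (1-t) ω₂` (`t < 1`, `ω₁, ω₂` invariant)
minimises the mean energy, so does `ω₂`. [folklore] -/
theorem IsMeanEnergyMinimiser.of_mix_right {Φ : LatticeInteraction d q} {R t : ℝ} {ht₀ : 0 ≤ t}
    {ht₁ : t ≤ 1} {ω₁ ω₂ : InfVolState d q} (ht : t < 1) (h₁ : ω₁.IsTranslationInvariant)
    (h₂ : ω₂.IsTranslationInvariant) (h : (mix t ht₀ ht₁ ω₁ ω₂).IsMeanEnergyMinimiser Φ R) :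
    ω₂.IsMeanEnergyMinimiser Φ R := by
  refine ⟨h₂, fun ω' hω' => ?_⟩
  have hm₁ := h.2 ω₁ h₁
  have hm₂ := h.2 ω₂ h₂
  have hm' := h.2 ω' hω'
  rw [meanEnergy_mix] at hm₁ hm₂ hm'
  nlinarith

/-- **Extremal minimisers are ergodic**: a mean-energy minimiser which is extremal among the
minimisers (every decomposition `ω = t ω₁ + (1-t) ω₂`, `0 < t < 1`, into MINIMISERS is trivial)
is extremal among all translation-invariant states, i.e. ergodic — because the minimisers form a
face (`of_mix_left/right`). With `BratteliKishimotoRobinson1978_theorem2` this says: the extreme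
points of the set of translation-invariant ground states are ergodic states.
[cite: BratteliRobinsonI1987, §4.3.1 (faces of E^G and ergodic states)] -/
theorem IsMeanEnergyMinimiser.isErgodic_of_extremal {Φ : LatticeInteraction d q} {R : ℝ}
    {ω : InfVolState d q} (h : ω.IsMeanEnergyMinimiser Φ R)
    (hext : ∀ (t : ℝ) (ht₀ : 0 ≤ t) (ht₁ : t ≤ 1) (ω₁ ω₂ : InfVolState d q), 0 < t → t < 1 →
      ω₁.IsMeanEnergyMinimiser Φ R → ω₂.IsMeanEnergyMinimiser Φ R → mix t ht₀ ht₁ ω₁ ω₂ = ω →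
        ω₁ = ω ∧ ω₂ = ω) :
    ω.IsErgodic := by
  refine ⟨h.1, fun t ht₀ ht₁ ω₁ ω₂ ht ht' h₁ h₂ hmix => hext t ht₀ ht₁ ω₁ ω₂ ht ht' ?_ ?_ hmix⟩
  · exact IsMeanEnergyMinimiser.of_mix_left ht h₁ h₂ (hmix ▸ h)
  · exact IsMeanEnergyMinimiser.of_mix_right ht' h₁ h₂ (hmix ▸ h)

end InfVolState

/-! ### The named fact -/

/-- **Bratteli–Kishimoto–Robinson 1978, Theorem 2: translation-invariant ground states are
exactly the translation-invariant minimisers of the energy per unit volume.** For a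
translation-invariant, Hermitian interaction `Φ` of finite range `R` on the quantum spin system
`ℤ^d` (local dimension `q`) and a translation-invariant infinite-volume state `ω`, the following
are equivalent: (1) `ω` is a ground state of `Φ` (`-i ω(A⋆ δ(A)) ≥ 0` for all local `A`,
`InfVolState.IsGroundState Φ R`); (2) `ω` minimises the mean energy `e_Φ = Re ω(E_Φ)`,
`E_Φ = Σ_{X∋0} Φ(X)/|X|`, among the translation-invariant states. Printed for all
`ℤ^ν`-invariant `Φ` with `Σ_{X∋0} ‖Φ(X)‖ e^{λ|X|} < ∞` (finite range is a special case) and with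
`H_Φ(ω) = lim ω(H_Φ(Λ))/|Λ|`, which equals `ω(E_Φ)` on invariant states (module docstring,
"Rendering"); `1 ⇒ 2` is the source's, `2 ⇒ 1` is Ruelle 1968. A named fact (D-0014): users take
`(h : BratteliKishimotoRobinson1978_theorem2)`; its convexity consequences (face property,
ergodicity of extremal minimisers) are theorems of this file.
[cite: BratteliKishimotoRobinson1978, Thm. 2 (p. 47)]
[cite: BratteliRobinsonII1997, §6.2.7 (restatement) and §6.2.4 (mean energy)] -/
def BratteliKishimotoRobinson1978_theorem2 : Prop :=
  ∀ (d q : ℕ) (Φ : LatticeInteraction d q) (R : ℝ), Φ.HasFiniteRange R → Φ.IsHermitian →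
    Φ.IsTranslationInvariant → ∀ ω : InfVolState d q, ω.IsTranslationInvariant →
      (ω.IsGroundState Φ R ↔
        ∀ ω' : InfVolState d q, ω'.IsTranslationInvariant → ω.meanEnergy Φ R ≤ ω'.meanEnergy Φ R)

/-- Hypothesis form: given the fact, a translation-invariant state is a ground state iff it is a
mean-energy minimiser (`InfVolState.IsMeanEnergyMinimiser`).
[cite: BratteliKishimotoRobinson1978, Thm. 2] -/
theorem BratteliKishimotoRobinson1978_theorem2.isGroundState_iff
    (h : BratteliKishimotoRobinson1978_theorem2) {Φ : LatticeInteraction d q} {R : ℝ}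
    (hR : Φ.HasFiniteRange R) (hH : Φ.IsHermitian) (hΦ : Φ.IsTranslationInvariant)
    {ω : InfVolState d q} (hω : ω.IsTranslationInvariant) :
    ω.IsGroundState Φ R ↔ ω.IsMeanEnergyMinimiser Φ R :=
  (h d q Φ R hR hH hΦ ω hω).trans ⟨fun h' => ⟨hω, h'⟩, fun h' => h'.2⟩

/-- **The translation-invariant ground states form a face of the invariant states** (given the
fact): if a non-trivial mixture `t ω₁ + (1-t) ω₂` (`0 < t < 1`) of translation-invariant states
is a ground state, then so are `ω₁` and `ω₂`. (So the set of invariant ground states is a face of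
`E^{ℤ^d}`, and its extreme points are ergodic, `IsMeanEnergyMinimiser.isErgodic_of_extremal`.)
[cite: BratteliKishimotoRobinson1978, Thm. 2] [cite: BratteliRobinsonI1987, §4.3.1] -/
theorem BratteliKishimotoRobinson1978_theorem2.isGroundState_of_mix
    (h : BratteliKishimotoRobinson1978_theorem2) {Φ : LatticeInteraction d q} {R : ℝ}
    (hR : Φ.HasFiniteRange R) (hH : Φ.IsHermitian) (hΦ : Φ.IsTranslationInvariant)
    {t : ℝ} {ht₀ : 0 ≤ t} {ht₁ : t ≤ 1} (ht : 0 < t) (ht' : t < 1) {ω₁ ω₂ : InfVolState d q}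
    (h₁ : ω₁.IsTranslationInvariant) (h₂ : ω₂.IsTranslationInvariant)
    (hgs : (InfVolState.mix t ht₀ ht₁ ω₁ ω₂).IsGroundState Φ R) :
    ω₁.IsGroundState Φ R ∧ ω₂.IsGroundState Φ R := by
  have hmin : (InfVolState.mix t ht₀ ht₁ ω₁ ω₂).IsMeanEnergyMinimiser Φ R :=
    (h.isGroundState_iff hR hH hΦ (h₁.mix h₂ t ht₀ ht₁)).1 hgs
  exact ⟨(h.isGroundState_iff hR hH hΦ h₁).2 (hmin.of_mix_left ht h₁ h₂),
    (h.isGroundState_iff hR hH hΦ h₂).2 (hmin.of_mix_right ht' h₁ h₂)⟩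

end Literature.MathematicalPhysics.QuantumLattice

end
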